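import Summits.PneNP.PneNP.Theorems.PeaTwoMemBPP.Negative.CensusMultiplicative
import Mathlib.Tactic.ReduceModChar

/-!
# PneNP / SzkEntropy — crux `PeaTwoMemBPP` (stmt-PneNP-10778), negative side, support: character sums of degree-≤2 Boolean functions on elementary abelian 2-groups

Route `PneNP/SzkEntropy`, crux stmt-PneNP-10778.  Support file for `NoXiIndependentQuadraticEncoding.lean` (the
"no entropy-exact local quadratic gadget" theorem of the crux's `Disproof.lean` §10).  Self-contained, elementary:

* `bderiv f a` (`D_a f(x) = f(x+a) + f(x)`), `IsDeg1` / `IsDeg2` = vanishing of all second / third derivatives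
  (for `F₂ⁿ`: the Reed–Muller codes `RM(1,n)`, `RM(2,n)`), `charSum f = Σ_x (−1)^{f(x)} ∈ ℤ`;
* `charSum_eq_zero_of_deg1`: a non-constant affine function is balanced;
* `charSum_sq`: `S(f)² = Σ_a S(D_a f)`; `radSet f` = directions of constant derivative (closed under `+`,
  `add_mem_radSet`; `a ↦ f(a)+f(0)` additive on it, `chi_add`; unchanged by adding an additive function,
  `radSet_add_hom`);
* `charSum_sq_dichotomy`: **for `f` of degree `≤ 2` on a group with `x + x = 0`, `S(f)² ∈ {0, |G|·|radSet f|}`** —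
  the elementary half of Dickson's theorem (`|S(f)| ∈ {0, 2^{n−h}}`), which is all the application needs;
* `charSum_eq_zero_of_eq_three_mul`: **if `S(f) = 3·S(f + ℓ)` with `ℓ` additive then `S(f) = 0`** ("3 ∤ 2ʲ").

References: F. J. MacWilliams, N. J. A. Sloane, *The Theory of Error-Correcting Codes* (1977), Ch. 13 §3 (Reed–Muller
codes and derivatives), Ch. 15 §2 Thm 4–5 (character sums of quadratic Boolean functions); L. E. Dickson, *Linear
Groups* (1901), §199.
-/

namespace Summit.PneNP.PneNP.Theorems.PeaTwoMemBPP.Negative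

open Finset

section Algebra

variable {G : Type*} [AddCommGroup G]

/-- The derivative `D_a f (x) = f(x + a) + f(x)`. [MacWilliamsSloane1977, Ch. 13 §3] -/
def bderiv (f : G → ZMod 2) (a : G) : G → ZMod 2 := fun x => f (x + a) + f x

/-- Degree `≤ 1` (affine): all second derivatives vanish. [MacWilliamsSloane1977, Ch. 13 §3] -/
def IsDeg1 (g : G → ZMod 2) : Prop := ∀ x d e : G, g (x + d + e) + g (x + d) + g (x + e) + g x = 0

/-- Degree `≤ 2`: all third derivatives vanish (for `F₂ⁿ` this is Reed–Muller `RM(2,n)`).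
[MacWilliamsSloane1977, Ch. 13 §3] -/
def IsDeg2 (f : G → ZMod 2) : Prop :=
  ∀ x a b d : G, f (x + a + b + d) + f (x + a + b) + f (x + a + d) + f (x + b + d) +
    f (x + a) + f (x + b) + f (x + d) + f x = 0

/-- `sgn 1 = −1`. [folklore] -/
theorem sgn_one : sgn 1 = -1 := rfl

/-- `sgn 0 = 1`. [folklore] -/
theorem sgn_zero : sgn 0 = 1 := rfl

/-- `sgn t ≠ 0`. [folklore] -/
theorem sgn_ne_zero (t : ZMod 2) : sgn t ≠ 0 := by
  unfold sgn; split_ifs <;> norm_num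

/-- In `ZMod 2`, distinct elements sum to `1`. [folklore] -/
theorem add_eq_one_of_ne {p q : ZMod 2} (h : p ≠ q) : p + q = 1 := by
  revert h; revert p q; decide

/-- Derivatives of a degree-`≤ 2` function are affine. [MacWilliamsSloane1977, Ch. 13 §3] -/
theorem deg1_deriv {f : G → ZMod 2} (hf : IsDeg2 f) (a : G) : IsDeg1 (bderiv f a) := by
  intro x d e
  have h := hf x d e a
  unfold bderiv
  have e1 : x + d + a = x + a + d := by abel
  have e2 : x + e + a = x + a + e := by abel
  have e3 : x + d + e + a = x + a + d + e := by abel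
  rw [e1, e2, e3]
  have e4 : x + a + d + e = x + d + e + a := by abel
  have e5 : x + a + d = x + d + a := by abel
  have e6 : x + a + e = x + e + a := by abel
  rw [e4, e5, e6]
  linear_combination h

/-- An affine function satisfies `g(x + d) = g(x) + g(d) + g(0)`. [folklore] -/
theorem deg1_translate {g : G → ZMod 2} (hg : IsDeg1 g) (x d : G) : g (x + d) = g x + (g d + g 0) := by
  have h := hg 0 x d
  simp only [zero_add] at h
  linear_combination (norm := ring_nf) h
  all_goals reduce_mod_char

/-- `f + ℓ` has degree `≤ 2` if `f` has and `ℓ` is additive. [folklore] -/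
theorem deg2_add_hom {f : G → ZMod 2} (hf : IsDeg2 f) (ℓ : G →+ ZMod 2) :
    IsDeg2 (fun x => f x + ℓ x) := by
  intro x a b d
  have h := hf x a b d
  simp only [map_add]
  linear_combination (norm := ring_nf) h
  all_goals reduce_mod_char

/-- Sums of degree-`≤ 2` functions have degree `≤ 2`. [folklore] -/
theorem deg2_add {f g : G → ZMod 2} (hf : IsDeg2 f) (hg : IsDeg2 g) : IsDeg2 (fun x => f x + g x) := by
  intro x a b d
  have h1 := hf x a b d
  have h2 := hg x a b d
  linear_combination h1 + h2

end Algebra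

section Sums

variable {G : Type*} [AddCommGroup G] [Fintype G]

/-- The character sum `S(f) = Σ_x (−1)^{f(x)} ∈ ℤ` of a Boolean function. [MacWilliamsSloane1977, Ch. 15 §2] -/
def charSum (f : G → ZMod 2) : ℤ := ∑ x, sgn (f x)

/-- **A non-constant affine Boolean function is balanced**: its character sum vanishes (translation by
`d` with `g(d) ≠ g(0)` flips every sign). [MacWilliamsSloane1977, Ch. 15 §2] -/
theorem charSum_eq_zero_of_deg1 {g : G → ZMod 2} (hg : IsDeg1 g) {d : G} (hd : g d ≠ g 0) :
    charSum g = 0 := by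
  have h1 : g d + g 0 = 1 := add_eq_one_of_ne hd
  have e := Equiv.sum_comp (Equiv.addRight d) (fun x => sgn (g x))
  simp only [Equiv.coe_addRight] at e
  have hneg : ∑ x, sgn (g (x + d)) = -∑ x, sgn (g x) := by
    rw [← Finset.sum_neg_distrib]
    refine Finset.sum_congr rfl fun x _ => ?_
    rw [deg1_translate hg x d, h1, sgn_add, sgn_one]
    ring
  unfold charSum
  linarith

/-- **Squaring the character sum**: `S(f)² = Σ_a S(D_a f)`. [MacWilliamsSloane1977, Ch. 15 §2] -/
theorem charSum_sq (f : G → ZMod 2) : charSum f ^ 2 = ∑ a, charSum (bderiv f a) := by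
  unfold charSum bderiv
  rw [sq, Finset.sum_mul_sum]
  have h : ∀ x : G, ∑ y, sgn (f x) * sgn (f y) = ∑ a, sgn (f x) * sgn (f (x + a)) := fun x => by
    rw [← Equiv.sum_comp (Equiv.addLeft x) (fun y => sgn (f x) * sgn (f y))]
    simp only [Equiv.coe_addLeft]
  rw [Finset.sum_congr rfl fun x _ => h x, Finset.sum_comm]
  refine Finset.sum_congr rfl fun a _ => Finset.sum_congr rfl fun x _ => ?_
  rw [sgn_add, mul_comm]

/-- The radical: directions along which the derivative is constant. [MacWilliamsSloane1977, Ch. 15 §2] -/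
def radSet (f : G → ZMod 2) : Finset G := univ.filter fun a => ∀ x, bderiv f a x = bderiv f a 0

/-- Membership in the radical, unfolded. [folklore] -/
theorem mem_radSet {f : G → ZMod 2} {a : G} : a ∈ radSet f ↔ ∀ x, f (x + a) + f x = f a + f 0 := by
  unfold radSet bderiv
  simp only [Finset.mem_filter, Finset.mem_univ, true_and, zero_add]

/-- `0` is in the radical. [folklore] -/
theorem zero_mem_radSet (f : G → ZMod 2) : (0 : G) ∈ radSet f :=
  mem_radSet.2 fun x => by
    rw [add_zero]
    generalize f x = p; generalize f 0 = q; revert p q; decide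

/-- On the radical the character sum of the derivative is `±|G|`. [MacWilliamsSloane1977, Ch. 15 §2] -/
theorem charSum_deriv_of_mem {f : G → ZMod 2} {a : G} (ha : a ∈ radSet f) :
    charSum (bderiv f a) = Fintype.card G * sgn (f a + f 0) := by
  unfold charSum
  have h : ∀ x, bderiv f a x = f a + f 0 := fun x => mem_radSet.1 ha x
  rw [Finset.sum_congr rfl fun x _ => by rw [h x], Finset.sum_const, Finset.card_univ, nsmul_eq_mul]

/-- Off the radical the derivative is a non-constant affine function, so its character sum is `0`.
[MacWilliamsSloane1977, Ch. 15 §2] -/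
theorem charSum_deriv_of_not_mem {f : G → ZMod 2} (hf : IsDeg2 f) {a : G} (ha : a ∉ radSet f) :
    charSum (bderiv f a) = 0 := by
  have h : ∃ x, bderiv f a x ≠ bderiv f a 0 := by
    by_contra h
    push Not at h
    exact ha (Finset.mem_filter.2 ⟨Finset.mem_univ _, h⟩)
  obtain ⟨x, hx⟩ := h
  exact charSum_eq_zero_of_deg1 (deg1_deriv hf a) hx

/-- `S(f)² = |G| · Σ_{a ∈ R} (−1)^{f(a)+f(0)}` for `f` of degree `≤ 2`. [MacWilliamsSloane1977, Ch. 15 §2] -/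
theorem charSum_sq_eq {f : G → ZMod 2} (hf : IsDeg2 f) :
    charSum f ^ 2 = Fintype.card G * ∑ a ∈ radSet f, sgn (f a + f 0) := by
  rw [charSum_sq, Finset.mul_sum, radSet, Finset.sum_filter]
  refine Finset.sum_congr rfl fun a _ => ?_
  by_cases ha : a ∈ radSet f
  · rw [if_pos ((Finset.mem_filter.1 ha).2), charSum_deriv_of_mem ha]
  · rw [charSum_deriv_of_not_mem hf ha, if_neg]
    exact fun h => ha (Finset.mem_filter.2 ⟨Finset.mem_univ _, h⟩)

/-- The radical is closed under addition. [MacWilliamsSloane1977, Ch. 15 §2] -/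
theorem add_mem_radSet {f : G → ZMod 2} {a b : G} (ha : a ∈ radSet f) (hb : b ∈ radSet f) :
    a + b ∈ radSet f := by
  rw [mem_radSet] at ha hb ⊢
  intro x
  have h1 := hb (x + a)
  have h2 := ha x
  have h3 := hb a
  rw [show x + (a + b) = x + a + b by abel]
  linear_combination (norm := ring_nf) h1 + h2 + h3
  all_goals reduce_mod_char

/-- On the radical, `a ↦ f(a) + f(0)` is additive. [MacWilliamsSloane1977, Ch. 15 §2] -/
theorem chi_add {f : G → ZMod 2} {a : G} (ha : a ∈ radSet f) (b : G) :
    f (a + b) + f 0 = (f a + f 0) + (f b + f 0) := by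
  have h := mem_radSet.1 ha b
  rw [show a + b = b + a by abel]
  linear_combination (norm := ring_nf) h
  all_goals reduce_mod_char

/-- Adding an additive function does not change the radical. [MacWilliamsSloane1977, Ch. 15 §2] -/
theorem radSet_add_hom (f : G → ZMod 2) (ℓ : G →+ ZMod 2) :
    radSet (fun x => f x + ℓ x) = radSet f := by
  ext a
  rw [mem_radSet, mem_radSet]
  simp only [map_add, map_zero, add_zero]
  constructor
  · intro h x
    have := h x
    linear_combination (norm := ring_nf) this
    all_goals reduce_mod_char
  · intro h x
    have := h x
    linear_combination (norm := ring_nf) this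
    all_goals reduce_mod_char

variable [DecidableEq G]

/-- **Dichotomy**: for a degree-`≤ 2` function on an elementary abelian 2-group,
`Σ_{a∈R}(−1)^{f(a)+f(0)}` is `0` (if the additive map is non-trivial on `R`: translation by such an `a₀`
flips all signs) or `|R|`. [MacWilliamsSloane1977, Ch. 15 §2 (Dickson's theorem, elementary half)] -/
theorem radSum_dichotomy {f : G → ZMod 2} (h2 : ∀ x : G, x + x = 0) :
    (∑ a ∈ radSet f, sgn (f a + f 0)) = 0 ∨
      (∑ a ∈ radSet f, sgn (f a + f 0)) = (radSet f).card := by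
  by_cases hχ : ∃ a₀ ∈ radSet f, f a₀ + f 0 = 1
  · left
    obtain ⟨a₀, ha₀, h1⟩ := hχ
    -- membership in the radical is invariant under translation by a₀
    have hiff : ∀ a : G, a + a₀ ∈ radSet f ↔ a ∈ radSet f := by
      intro a
      constructor
      · intro h
        have := add_mem_radSet h ha₀
        rwa [add_assoc, h2 a₀, add_zero] at this
      · intro h
        exact add_mem_radSet h ha₀
    have key : ∑ a ∈ radSet f, sgn (f a + f 0) = -∑ a ∈ radSet f, sgn (f a + f 0) := by
      have step : ∑ a ∈ radSet f, sgn (f a + f 0) =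
          ∑ a, if a ∈ radSet f then sgn (f a + f 0) else 0 := by
        rw [← Finset.sum_filter]; congr 1; ext a; simp
      rw [step, ← Finset.sum_neg_distrib, ← Equiv.sum_comp (Equiv.addRight a₀)]
      simp only [Equiv.coe_addRight]
      refine Finset.sum_congr rfl fun a _ => ?_
      by_cases ha : a ∈ radSet f
      · rw [if_pos ((hiff a).2 ha), if_pos ha, show a + a₀ = a₀ + a by abel, chi_add ha₀ a, h1,
          sgn_add, sgn_one]
        ring
      · rw [if_neg (fun h => ha ((hiff a).1 h)), if_neg ha, neg_zero]
    linarith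
  · right
    push Not at hχ
    rw [Finset.card_eq_sum_ones]
    push_cast
    refine Finset.sum_congr rfl fun a ha => ?_
    have : f a + f 0 = 0 := by
      have h := hχ a ha
      revert h; generalize f a + f 0 = p; revert p; decide
    rw [this, sgn_zero]

/-- **`S(f)² ∈ {0, |G|·|R|}`** for `f` of degree `≤ 2` on an elementary abelian 2-group.
[MacWilliamsSloane1977, Ch. 15 §2, Thm 4–5 (elementary half)] -/
theorem charSum_sq_dichotomy {f : G → ZMod 2} (hf : IsDeg2 f) (h2 : ∀ x : G, x + x = 0) :
    charSum f ^ 2 = 0 ∨ charSum f ^ 2 = Fintype.card G * (radSet f).card := by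
  rcases radSum_dichotomy (f := f) h2 with h | h
  · left; rw [charSum_sq_eq hf, h, mul_zero]
  · right; rw [charSum_sq_eq hf, h]

/-- **The `3 ∤ 2ʲ` step**: if `S(f) = 3·S(f + ℓ)` for a degree-`≤ 2` function `f` and an additive `ℓ`,
then `S(f) = 0` (both squares lie in `{0, |G|·|R|}` with the same `R`). [folklore] -/
theorem charSum_eq_zero_of_eq_three_mul {f : G → ZMod 2} (hf : IsDeg2 f) (ℓ : G →+ ZMod 2)
    (h2 : ∀ x : G, x + x = 0) (h : charSum f = 3 * charSum (fun x => f x + ℓ x)) : charSum f = 0 := by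
  have hg : IsDeg2 (fun x => f x + ℓ x) := deg2_add_hom hf ℓ
  have hR : radSet (fun x => f x + ℓ x) = radSet f := radSet_add_hom f ℓ
  have hpos : (0 : ℤ) < Fintype.card G * (radSet f).card := by
    have h0 : 0 < (radSet f).card := Finset.card_pos.2 ⟨0, zero_mem_radSet f⟩
    have h1 : 0 < Fintype.card G := Fintype.card_pos
    positivity
  have two_ne : (2 : ℕ) ≠ 0 := by norm_num
  rcases charSum_sq_dichotomy hg h2 with hg0 | hg1
  · have : charSum (fun x => f x + ℓ x) = 0 := (pow_eq_zero_iff two_ne).1 hg0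
    rw [h, this, mul_zero]
  · rw [hR] at hg1
    rcases charSum_sq_dichotomy hf h2 with hf0 | hf1
    · exact (pow_eq_zero_iff two_ne).1 hf0
    · exfalso
      have : charSum f ^ 2 = 9 * charSum (fun x => f x + ℓ x) ^ 2 := by rw [h]; ring
      rw [hf1, hg1] at this
      linarith

end Sums

end Summit.PneNP.PneNP.Theorems.PeaTwoMemBPP.Negative
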